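import Summits.HodgeConjecture.HodgeConjecture.Theorems.HodgeLocusCensusJoinStackRank6
import Summits.HodgeConjecture.HodgeConjecture.Theorems.HodgeLocusCensusJoinStackRank8
import Summits.HodgeConjecture.HodgeConjecture.Theorems.HodgeLocusCensusJoinStackCerts
import Summits.HodgeConjecture.HodgeConjecture.Theorems.HodgeLocusCensusDoubleBlockCells
import HarnessLib

/-!
# HodgeLocusCensusJoinStackCells — the double-block stacked rows `DoubleBlock.stackRankJEE_JEL_{6,8}_4` are theorems (cell pub-hlocus, LEAD gen 5, (T40))
HONEST FRAMING: certified instances and evidence bearing on the general Hodge conjecture; no claim.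

PROVED ROWS (the last two of the 54 conjecture-tagged typed rank rows of the census):
`DoubleBlock.stackRankJEE_JEL_6_4` — rank [M_{J(E,E′)} ; M_{J(E,L′)}] = 91 on X⁴₆ — and `DoubleBlock.stackRankJEE_JEL_8_4` — = 187 on X⁴₈ —
over every field of characteristic 0 and every primitive 8th root ζ, by the Kronecker stacked certificate `jeeJelCert`
(`HodgeLocusCensusJoinStackCerts`, validity decided by the kernel) and the rank theorems `ivhsJoinStackRankEq_of_cert{6,8}`. The encodings
`DoubleBlock.joinEE6/8` and `GrSection.fourPlanes6/8` of the census file are identified with the 4-twist plane lists of `jeeL`, `jelL`.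
With these two rows all 54 typed rank rows of the Hodge-locus census carry kernel-checked proofs.
-/

namespace Summit.HodgeConjecture.HodgeConjecture.HodgeLocus.Census.PlaneSum

open TwistCells GrSection

/-- the top layer of `DoubleBlock.stackRankJEE_JEL_6_4` is the 4-twist plane list of `jeeL` … -/
theorem joinEE6_list : DoubleBlock.joinEE6 = planeList6q jeeL := by
  simp [DoubleBlock.joinEE6, planeList6q, jeeL]
/-- … and the bottom layer that of `jelL`. -/
theorem fourPlanes6_qlist : fourPlanes6 = planeList6q jelL := by
  simp [fourPlanes6, planeList6q, jelL]

/-- PROVED ROW: `DoubleBlock.stackRankJEE_JEL_6_4` — rank [M_{J(E,E′)} ; M_{J(E,L′)}] = 91 on X⁴₆. -/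
theorem stackRankJEE_JEL_6_4_holds : DoubleBlock.stackRankJEE_JEL_6_4 := by
  unfold DoubleBlock.stackRankJEE_JEL_6_4
  rw [joinEE6_list, fourPlanes6_qlist]
  exact ivhsJoinStackRankEq_of_cert6 jeeL jelL jeeJelCert jeeJel_valid jeeJelModeK6 jeeJelOff6 jeeJel_H1_6 jeeJel_H2_6 jeeJel_H3_6

/-- the top layer of `DoubleBlock.stackRankJEE_JEL_8_4` is the 4-twist plane list of `jeeL` … -/
theorem joinEE8_list : DoubleBlock.joinEE8 = planeList8q jeeL := by
  simp [DoubleBlock.joinEE8, planeList8q, jeeL]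
/-- … and the bottom layer that of `jelL`. -/
theorem fourPlanes8_qlist : fourPlanes8 = planeList8q jelL := by
  simp [fourPlanes8, planeList8q, jelL]

/-- PROVED ROW: `DoubleBlock.stackRankJEE_JEL_8_4` — rank [M_{J(E,E′)} ; M_{J(E,L′)}] = 187 on X⁴₈. -/
theorem stackRankJEE_JEL_8_4_holds : DoubleBlock.stackRankJEE_JEL_8_4 := by
  unfold DoubleBlock.stackRankJEE_JEL_8_4
  rw [joinEE8_list, fourPlanes8_qlist]
  exact ivhsJoinStackRankEq_of_cert8 jeeL jelL jeeJelCert jeeJel_valid jeeJelModeK8 jeeJelOff8 jeeJel_H1_8 jeeJel_H2_8 jeeJel_H3_8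

end Summit.HodgeConjecture.HodgeConjecture.HodgeLocus.Census.PlaneSum
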